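import Literature.AlgebraicGeometry.Frobenioids.PadicFrobenioidGoodLocalKit
import Literature.AlgebraicGeometry.Frobenioids.FiberProducts
import HarnessLib

/-!
# Frobenioids I, §0 / Theorem 5.2 (i): the model Frobenioid of RESTRICTED data `(Φ|_{D′}, B|_{D′}, Div_B|_{D′})`
# IS the categorical fibre product `C ×_D D′` — and the §0 invariances of `C₁ ×_D C₂` under equivalences

Mochizuki, *The geometry of Frobenioids I: the general theory*, Kyushu J. Math. **62** (2008) 293–400, kurims
text: §0 p. 17 ("the *categorical fiber product* … One verifies easily that if `Φ₂` is an equivalence, then the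
natural projection functor `C₁ ×_D C₂ → C₁` is also an equivalence") [cite: MochizukiFrdI2008, §0 p.17];
Theorem 5.2 (i) p. 100 (the model Frobenioid of data `(Φ, B, Div_B)` over `D`: objects `(A_D, α)`, arrows
`(deg_Fr, Base, Div, u)` subject to relation (d)) [cite: MochizukiFrdI2008, Thm. 5.2(i) p.100]; Proposition 1.6
p. 27 (the base-changed category `C′ := C ×_D D′` along `D′ → D`, with divisor monoid "the restriction `Φ′` of `Φ`
to `D′`") [cite: MochizukiFrdI2008, Prop. 1.6 p.27].

PROOF-ONLY file (cell abc-iut, layer L1, seat abc-iut-f-027 — the [FrdII] §1–§3 typer lineage that landed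
`ModelFrobenioid.baseChange` / `divBRestrict` in `PadicFrobenioidGoodLocalKit.lean`), 0 definitions, every
equivalence recorded as an EXISTENCE statement together with its compatibilities with the projections ON THE NOSE
(functor equalities, all `rfl` on the constructed functors), so that consumers transport `1`-commutative squares
along them (`PreFrobenioidData.OneUniqueSquare.of_equiv_top` / `of_iso_sides`):

* §1 (§0 bookkeeping for `C₁ ×_D C₂ = CFP Φ₁ Φ₂`): `CFP.exists_equivalence_precomp` — replacing `C₁` by an
  equivalent category `E : C₁′ ⥲ C₁` (corner functor `E ⋙ Φ₁`) yields an equivalent fibre product, over `E` on the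
  first projection and the identity on the second; `CFP.exists_equivalence_of_iso_left` — replacing `Φ₁` by an
  isomorphic functor yields an equivalent (indeed isomorphic) fibre product, identity on both projections;
  `CFP.exists_equivalence_postcomp` — composing BOTH corner functors with a fully faithful `I : D ⥤ D″` yields an
  equivalent fibre product, identity on both projections (only the gluing isomorphisms are re-expressed through `I`);
* §2 (Thm. 5.2 (i) ⟂ Prop. 1.6): **`ModelFrobenioid.exists_restrict_equivalence_fiberProduct`** — for every functor
  of bases `G : D′ ⥤ D`, the model Frobenioid of the restricted data `(G^op ⋙ Φ, G^op ⋙ B, Div_B|_{D′})` over `D′` is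
  EQUIVALENT to the categorical fibre product `ModelFrobenioid Φ B Div_B ×_D D′` of the base functor with `G`, by
  `(A′, α) ↦ ((G A′, α), A′, id)`; the equivalence lies over abc-iut-f-027-lineage's `baseChange G` on the first
  projection and over the base functor `→ D′` on the second, ON THE NOSE.  (The model-Frobenioid twin of L1's
  `ElemFrobenioid.toFiberProduct_isEquivalence` for elementary Frobenioids, `FiberProducts.lean`.)

Consumer: [IUTchI] Ex. 5.1 (iii) `†ℱ^⊚ := †ℱ^⊛|_{†𝒟^⊚}` (abc-iut-L5-t1's `GlobalFrobenioid.Fcirc`, a `CFP`) as a MODEL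
Frobenioid over `†𝒟^⊚`, whence [FrdI] Cor. 4.11 (ii) for `†ℱ^⊚` BY NAME (`ModelFrobenioid.exists_oneUniqueSquare_base_model`).
No statement of the paper is re-typed or strengthened; nothing here bears on [IUTchIII] Cor. 3.12.
-/

namespace Literature.AlgebraicGeometry.Frobenioids

open CategoryTheory Opposite

universe w v₁ v₂ v₃ v₄ u₁ u₂ u₃ u₄

/-! ### §1. `C₁ ×_D C₂` under an equivalence / isomorphism at a corner ([FrdI] §0 p. 17) -/

namespace CFP

section Precomp

variable {C₁ : Type u₁} [Category.{v₁} C₁] {C₁' : Type u₂} [Category.{v₂} C₁'] {C₂ : Type u₃} [Category.{v₃} C₂]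
  {D : Type u₄} [Category.{v₄} D]

/-- **`C₁′ ×_D C₂ ⥲ C₁ ×_D C₂` along an equivalence `E : C₁′ ⥲ C₁` of the first corner** (corner functor
`E ⋙ Φ₁`): `(A′, A₂, α) ↦ (E A′, A₂, α)` is an equivalence of categories, lying over `E` on the first projection
and over the identity on the second, on the nose ([FrdI] §0 p. 17, "one verifies easily …" bookkeeping).
[cite: MochizukiFrdI2008, §0 p.17] -/
theorem exists_equivalence_precomp (E : C₁' ≌ C₁) (Φ₁ : C₁ ⥤ D) (Φ₂ : C₂ ⥤ D) :
    ∃ e : CFP (E.functor ⋙ Φ₁) Φ₂ ≌ CFP Φ₁ Φ₂,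
      e.functor ⋙ proj₁ Φ₁ Φ₂ = proj₁ (E.functor ⋙ Φ₁) Φ₂ ⋙ E.functor ∧
        e.functor ⋙ proj₂ Φ₁ Φ₂ = proj₂ (E.functor ⋙ Φ₁) Φ₂ := by
  -- the comparison functor `(A′, A₂, α) ↦ (E A′, A₂, α)`
  let T : CFP (E.functor ⋙ Φ₁) Φ₂ ⥤ CFP Φ₁ Φ₂ :=
    { obj := fun X => ⟨E.functor.obj X.fst, X.snd, X.iso⟩
      map := fun f => ⟨E.functor.map f.fst, f.snd, f.w⟩
      map_id := fun X => hom_ext (E.functor.map_id _) rfl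
      map_comp := fun f g => hom_ext (E.functor.map_comp _ _) rfl }
  haveI : T.Faithful := ⟨fun {X Y} f g h =>
    hom_ext (E.functor.map_injective (congrArg (fun k : T.obj X ⟶ T.obj Y => k.fst) h))
      (congrArg (fun k : T.obj X ⟶ T.obj Y => k.snd) h)⟩
  haveI : T.Full := ⟨fun {X Y} h =>
    ⟨⟨E.functor.preimage h.fst, h.snd, by
        have hw : Φ₁.map h.fst ≫ Y.iso.hom = X.iso.hom ≫ Φ₂.map h.snd := h.w
        exact (congrArg (fun m => Φ₁.map m ≫ Y.iso.hom) (E.functor.map_preimage h.fst)).trans hw⟩,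
      hom_ext (E.functor.map_preimage _) rfl⟩⟩
  -- essential surjectivity: `(A₁, A₂, α) ≅ (E E⁻¹ A₁, A₂, Φ₁(ε_{A₁}) ≫ α)` by `(ε_{A₁}, id)`
  haveI : T.EssSurj := ⟨fun Y =>
    ⟨⟨E.inverse.obj Y.fst, Y.snd, Φ₁.mapIso (E.counitIso.app Y.fst) ≪≫ Y.iso⟩,
      ⟨isoMk (E.counitIso.app Y.fst) (Iso.refl _) (by
        change Φ₁.map (E.counitIso.hom.app Y.fst) ≫ Y.iso.hom =
          (Φ₁.map (E.counitIso.hom.app Y.fst) ≫ Y.iso.hom) ≫ Φ₂.map (𝟙 _)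
        rw [Φ₂.map_id, Category.comp_id])⟩⟩⟩
  haveI : T.IsEquivalence := {}
  exact ⟨T.asEquivalence, rfl, rfl⟩

/-- **`C₁ ×_D C₂` along an ISOMORPHIC first corner functor `Φ₁ ≅ Φ₁′`**: `(A₁, A₂, α) ↦ (A₁, A₂, i_{A₁}⁻¹ ≫ α)` is
an equivalence `CFP Φ₁ Φ₂ ⥲ CFP Φ₁′ Φ₂`, identity on BOTH projections on the nose ([FrdI] §0 p. 17 bookkeeping).
[cite: MochizukiFrdI2008, §0 p.17] -/
theorem exists_equivalence_of_iso_left {Φ₁ Φ₁' : C₁ ⥤ D} (i : Φ₁ ≅ Φ₁') (Φ₂ : C₂ ⥤ D) :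
    ∃ e : CFP Φ₁ Φ₂ ≌ CFP Φ₁' Φ₂,
      e.functor ⋙ proj₁ Φ₁' Φ₂ = proj₁ Φ₁ Φ₂ ∧ e.functor ⋙ proj₂ Φ₁' Φ₂ = proj₂ Φ₁ Φ₂ := by
  -- the two mutually inverse re-gluings
  let fwd : CFP Φ₁ Φ₂ ⥤ CFP Φ₁' Φ₂ :=
    { obj := fun X => ⟨X.fst, X.snd, (i.app X.fst).symm ≪≫ X.iso⟩
      map := fun {X Y} f => ⟨f.fst, f.snd, by
        change Φ₁'.map f.fst ≫ i.inv.app Y.fst ≫ Y.iso.hom = (i.inv.app X.fst ≫ X.iso.hom) ≫ Φ₂.map f.snd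
        rw [← Category.assoc, i.inv.naturality, Category.assoc, f.w, Category.assoc]⟩
      map_id := fun X => hom_ext rfl rfl
      map_comp := fun f g => hom_ext rfl rfl }
  let bwd : CFP Φ₁' Φ₂ ⥤ CFP Φ₁ Φ₂ :=
    { obj := fun Y => ⟨Y.fst, Y.snd, i.app Y.fst ≪≫ Y.iso⟩
      map := fun {X Y} f => ⟨f.fst, f.snd, by
        change Φ₁.map f.fst ≫ i.hom.app Y.fst ≫ Y.iso.hom = (i.hom.app X.fst ≫ X.iso.hom) ≫ Φ₂.map f.snd
        rw [← Category.assoc, i.hom.naturality, Category.assoc, f.w, Category.assoc]⟩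
      map_id := fun X => hom_ext rfl rfl
      map_comp := fun f g => hom_ext rfl rfl }
  let η : 𝟭 (CFP Φ₁ Φ₂) ≅ fwd ⋙ bwd := NatIso.ofComponents
    (fun X => isoMk (Iso.refl _) (Iso.refl _) (by
      change Φ₁.map (𝟙 _) ≫ i.hom.app X.fst ≫ i.inv.app X.fst ≫ X.iso.hom = X.iso.hom ≫ Φ₂.map (𝟙 _)
      rw [Φ₁.map_id, Φ₂.map_id, Category.id_comp, Category.comp_id, Iso.hom_inv_id_app_assoc]))
    (fun {X Y} f => hom_ext
      (by change f.fst ≫ 𝟙 _ = 𝟙 _ ≫ f.fst; rw [Category.comp_id, Category.id_comp])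
      (by change f.snd ≫ 𝟙 _ = 𝟙 _ ≫ f.snd; rw [Category.comp_id, Category.id_comp]))
  let ε : bwd ⋙ fwd ≅ 𝟭 (CFP Φ₁' Φ₂) := NatIso.ofComponents
    (fun Y => isoMk (Iso.refl _) (Iso.refl _) (by
      change Φ₁'.map (𝟙 _) ≫ Y.iso.hom = (i.inv.app Y.fst ≫ i.hom.app Y.fst ≫ Y.iso.hom) ≫ Φ₂.map (𝟙 _)
      rw [Φ₁'.map_id, Φ₂.map_id, Category.id_comp, Category.comp_id, Iso.inv_hom_id_app_assoc]))
    (fun {X Y} f => hom_ext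
      (by change f.fst ≫ 𝟙 _ = 𝟙 _ ≫ f.fst; rw [Category.comp_id, Category.id_comp])
      (by change f.snd ≫ 𝟙 _ = 𝟙 _ ≫ f.snd; rw [Category.comp_id, Category.id_comp]))
  exact ⟨CategoryTheory.Equivalence.mk fwd bwd η ε, rfl, rfl⟩

end Precomp

section Postcomp

variable {C₁ : Type u₁} [Category.{v₁} C₁] {C₂ : Type u₂} [Category.{v₂} C₂] {D : Type u₃} [Category.{v₃} D]
  {D'' : Type u₄} [Category.{v₄} D'']

/-- **`C₁ ×_D C₂ ⥲ C₁ ×_{D″} C₂` along a fully faithful `I : D ⥤ D″`** (corner functors `Φ₁ ⋙ I`, `Φ₂ ⋙ I`):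
the identity on both components, the gluing isomorphism `α ↦ I(α)` (inverse: `I.preimageIso`) — an equivalence,
identity on BOTH projections on the nose ([FrdI] §0 p. 17 bookkeeping; the transport used in [IUTchI] Ex. 5.1
(iii) along the identification `Base(†ℱ^⊛) ⥲ †𝒟^⊛`). [cite: MochizukiFrdI2008, §0 p.17] -/
theorem exists_equivalence_postcomp (Φ₁ : C₁ ⥤ D) (Φ₂ : C₂ ⥤ D) (I : D ⥤ D'') [I.Full] [I.Faithful] :
    ∃ e : CFP Φ₁ Φ₂ ≌ CFP (Φ₁ ⋙ I) (Φ₂ ⋙ I),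
      e.functor ⋙ proj₁ (Φ₁ ⋙ I) (Φ₂ ⋙ I) = proj₁ Φ₁ Φ₂ ∧ e.functor ⋙ proj₂ (Φ₁ ⋙ I) (Φ₂ ⋙ I) = proj₂ Φ₁ Φ₂ := by
  let fwd : CFP Φ₁ Φ₂ ⥤ CFP (Φ₁ ⋙ I) (Φ₂ ⋙ I) :=
    { obj := fun X => ⟨X.fst, X.snd, I.mapIso X.iso⟩
      map := fun {X Y} f => ⟨f.fst, f.snd, by
        change I.map (Φ₁.map f.fst) ≫ I.map Y.iso.hom = I.map X.iso.hom ≫ I.map (Φ₂.map f.snd)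
        rw [← I.map_comp, ← I.map_comp, f.w]⟩
      map_id := fun X => hom_ext rfl rfl
      map_comp := fun f g => hom_ext rfl rfl }
  let bwd : CFP (Φ₁ ⋙ I) (Φ₂ ⋙ I) ⥤ CFP Φ₁ Φ₂ :=
    { obj := fun Y => ⟨Y.fst, Y.snd, I.preimageIso Y.iso⟩
      map := fun {X Y} f => ⟨f.fst, f.snd, I.map_injective (by
        have hw : I.map (Φ₁.map f.fst) ≫ Y.iso.hom = X.iso.hom ≫ I.map (Φ₂.map f.snd) := f.w
        rw [I.map_comp, I.map_comp, I.preimageIso_hom, I.preimageIso_hom, I.map_preimage, I.map_preimage]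
        exact hw)⟩
      map_id := fun X => hom_ext rfl rfl
      map_comp := fun f g => hom_ext rfl rfl }
  let η : 𝟭 (CFP Φ₁ Φ₂) ≅ fwd ⋙ bwd := NatIso.ofComponents
    (fun X => isoMk (Iso.refl _) (Iso.refl _) (I.map_injective (by
      change I.map (Φ₁.map (𝟙 _) ≫ I.preimage (I.map X.iso.hom)) = I.map (X.iso.hom ≫ Φ₂.map (𝟙 _))
      rw [Φ₁.map_id, Φ₂.map_id, Category.id_comp, Category.comp_id, I.map_preimage])))
    (fun {X Y} f => hom_ext
      (by change f.fst ≫ 𝟙 _ = 𝟙 _ ≫ f.fst; rw [Category.comp_id, Category.id_comp])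
      (by change f.snd ≫ 𝟙 _ = 𝟙 _ ≫ f.snd; rw [Category.comp_id, Category.id_comp]))
  let ε : bwd ⋙ fwd ≅ 𝟭 (CFP (Φ₁ ⋙ I) (Φ₂ ⋙ I)) := NatIso.ofComponents
    (fun Y => isoMk (Iso.refl _) (Iso.refl _) (by
      change I.map (Φ₁.map (𝟙 _)) ≫ Y.iso.hom = I.map (I.preimage Y.iso.hom) ≫ I.map (Φ₂.map (𝟙 _))
      rw [Φ₁.map_id, Φ₂.map_id, I.map_id, I.map_id, Category.id_comp, Category.comp_id, I.map_preimage]))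
    (fun {X Y} f => hom_ext
      (by change f.fst ≫ 𝟙 _ = 𝟙 _ ≫ f.fst; rw [Category.comp_id, Category.id_comp])
      (by change f.snd ≫ 𝟙 _ = 𝟙 _ ≫ f.snd; rw [Category.comp_id, Category.id_comp]))
  exact ⟨CategoryTheory.Equivalence.mk fwd bwd η ε, rfl, rfl⟩

end Postcomp

end CFP

/-! ### §2. The model Frobenioid of restricted data IS the fibre product `C ×_D D′` ([FrdI] Thm. 5.2 (i) / Prop. 1.6) -/

namespace ModelFrobenioid

variable {D : Type u₁} [Category.{v₁} D] {D' : Type u₂} [Category.{v₂} D'] (G : D' ⥤ D)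
  (Φ B : Dᵒᵖ ⥤ CommMonCat.{w}) (DivB : B ⟶ monoidGp Φ)

/-- Along a base isomorphism `ι : A_D ≅ G A′`, the object `(G A′, Φ(ι⁻¹)^gp(α))` of the model Frobenioid is
isomorphic to `(A_D, α)` by `(1, ι⁻¹, 0, 0)` / `(1, ι, 0, 0)` — with the base component RECORDED (`Base(−) = ι⁻¹`),
as the fibre-product bookkeeping below needs. [cite: MochizukiFrdI2008, Thm. 5.2(i) p.100] -/
theorem exists_iso_of_baseIso (Y : ModelFrobenioid Φ B DivB) {A : D} (ι : Y.base ≅ A) :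
    ∃ i : (⟨A, pullGp Φ ι.inv Y.cls⟩ : ModelFrobenioid Φ B DivB) ≅ Y, baseMap i.hom = ι.inv := by
  refine ⟨{ hom := { degFr := 1, base := ι.inv, div := 1, unit := 1, rel := ?_ }
            inv := { degFr := 1, base := ι.hom, div := 1, unit := 1, rel := ?_ }
            hom_inv_id := ?_
            inv_hom_id := ?_ }, rfl⟩
  · rw [PNat.one_coe, pow_one, map_one, mul_one, map_one, mul_one]
  · rw [PNat.one_coe, pow_one, map_one, mul_one, map_one, mul_one, ← pullGp_comp, Iso.hom_inv_id, pullGp_id]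
  · apply hom_ext
    · rfl
    · exact ι.inv_hom_id
    · change (Φ.map ι.inv.op).hom 1 * 1 ^ ((1 : ℕ+) : ℕ) = 1
      rw [map_one, one_pow, mul_one]
    · change (B.map ι.inv.op).hom 1 * 1 ^ ((1 : ℕ+) : ℕ) = 1
      rw [map_one, one_pow, mul_one]
  · apply hom_ext
    · rfl
    · exact ι.hom_inv_id
    · change (Φ.map ι.hom.op).hom 1 * 1 ^ ((1 : ℕ+) : ℕ) = 1
      rw [map_one, one_pow, mul_one]
    · change (B.map ι.hom.op).hom 1 * 1 ^ ((1 : ℕ+) : ℕ) = 1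
      rw [map_one, one_pow, mul_one]

/-- **The model Frobenioid of the RESTRICTED data is the categorical fibre product `C ×_D D′`** ([FrdI] Thm. 5.2 (i)
with §0 / Prop. 1.6: "`C′ := C ×_D D′` … the restriction `Φ′` of `Φ` to `D′`"): for every functor of bases
`G : D′ ⥤ D`, the functor `(A′, α) ↦ ((G A′, α), A′, id_{G A′})`, `φ ↦ (baseChange φ, Base φ)` from
`ModelFrobenioid (G^op ⋙ Φ) (G^op ⋙ B) Div_B|_{D′}` to `CFP (ModelFrobenioid Φ B Div_B → D) G` is an EQUIVALENCE of
categories — faithful and full because an arrow of the fibre product over `((G A′, α), A′, id)`'s is a model arrow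
whose `Base` IS `G` of its `D′`-component, so that Thm. 5.2 (i)'s data `(deg_Fr, Base, Div, u)` and relation (d)
descend verbatim (the pull-backs of the restricted data ARE those of `Φ` along `G f`); essentially surjective because
`((A_D, α), A′, ι : A_D ≅ G A′) ≅ ((G A′, Φ(ι⁻¹)^gp α), A′, id)` by `((1, ι⁻¹, 0, 0), id)`.  It lies over
`baseChange G` (first projection) and over the base functor `→ D′` (second projection) ON THE NOSE.
[cite: MochizukiFrdI2008, Thm. 5.2(i) p.100] [cite: MochizukiFrdI2008, Prop. 1.6 p.27] -/
theorem exists_restrict_equivalence_fiberProduct :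
    ∃ e : ModelFrobenioid (G.op ⋙ Φ) (G.op ⋙ B) (divBRestrict G Φ B DivB) ≌ CFP (baseFunctor Φ B DivB) G,
      e.functor ⋙ CFP.proj₁ (baseFunctor Φ B DivB) G = baseChange G Φ B DivB ∧
        e.functor ⋙ CFP.proj₂ (baseFunctor Φ B DivB) G = baseFunctor (G.op ⋙ Φ) (G.op ⋙ B) (divBRestrict G Φ B DivB) := by
  let bc := baseChange G Φ B DivB
  -- the comparison functor
  let T : ModelFrobenioid (G.op ⋙ Φ) (G.op ⋙ B) (divBRestrict G Φ B DivB) ⥤ CFP (baseFunctor Φ B DivB) G :=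
    { obj := fun X => ⟨bc.obj X, X.base, Iso.refl _⟩
      map := fun {X Y} φ => ⟨bc.map φ, baseMap φ, by
        change G.map (baseMap φ) ≫ 𝟙 _ = 𝟙 _ ≫ G.map (baseMap φ)
        rw [Category.comp_id, Category.id_comp]⟩
      map_id := fun X => CFP.hom_ext (bc.map_id _) rfl
      map_comp := fun f g => CFP.hom_ext (bc.map_comp _ _) rfl }
  -- an arrow of the fibre product between objects in the image has `Base(first component) = G (second component)`
  have hw : ∀ {X Y : ModelFrobenioid (G.op ⋙ Φ) (G.op ⋙ B) (divBRestrict G Φ B DivB)} (f : T.obj X ⟶ T.obj Y),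
      Hom.base f.fst = G.map f.snd := fun {X Y} f => by
    have h := f.w
    change Hom.base f.fst ≫ 𝟙 _ = 𝟙 _ ≫ G.map f.snd at h
    rwa [Category.comp_id, Category.id_comp] at h
  haveI : T.Faithful := ⟨fun {X Y} φ ψ h => by
    have h1 := congrArg (fun f : T.obj X ⟶ T.obj Y => Hom.degFr f.fst) h
    have h2 := congrArg (fun f : T.obj X ⟶ T.obj Y => f.snd) h
    have h3 := congrArg (fun f : T.obj X ⟶ T.obj Y => Hom.div f.fst) h
    have h4 := congrArg (fun f : T.obj X ⟶ T.obj Y => Hom.unit f.fst) h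
    exact hom_ext h1 h2 h3 h4⟩
  haveI : T.Full := ⟨fun {X Y} f =>
    ⟨{ degFr := Hom.degFr (X := bc.obj X) (Y := bc.obj Y) f.fst
       base := f.snd
       div := Hom.div (X := bc.obj X) (Y := bc.obj Y) f.fst
       unit := Hom.unit (X := bc.obj X) (Y := bc.obj Y) f.fst
       rel := by
         have h := Hom.rel (X := bc.obj X) (Y := bc.obj Y) f.fst
         rw [hw f] at h
         exact h },
      CFP.hom_ext (hom_ext rfl (hw f).symm rfl rfl) rfl⟩⟩
  haveI : T.EssSurj := ⟨fun Y => by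
    obtain ⟨i, hi⟩ := exists_iso_of_baseIso Φ B DivB Y.fst Y.iso
    refine ⟨⟨Y.snd, pullGp Φ Y.iso.inv Y.fst.cls⟩, ⟨CFP.isoMk i (Iso.refl _) ?_⟩⟩
    change Hom.base i.hom ≫ Y.iso.hom = 𝟙 _ ≫ G.map (𝟙 _)
    rw [show Hom.base i.hom = Y.iso.inv from hi, Iso.inv_hom_id, G.map_id, Category.id_comp]⟩
  haveI : T.IsEquivalence := {}
  exact ⟨T.asEquivalence, rfl, rfl⟩

end ModelFrobenioid

end Literature.AlgebraicGeometry.Frobenioids
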